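import Summits.ValiantsHypothesis.ValiantsHypothesis.Theorems.BarrierLeverAnchoredDoorHitsLowerPairsBrickDegeneration
import Summits.ValiantsHypothesis.ValiantsHypothesis.Theorems.BarrierLeverAnchoredDoorHitsLowerPairsCubeBall

/-!
# Support item `AnchoredDoorHitsLowerPairs` (stmt-ValiantsHypothesis-22510), line `anchored-peeling`:
# the PROFILE-ONE door 𝔄₁ has nonzero symbolic minor on cube-versus-Hamming-ball, every `k`

Helper file (`--supports stmt-ValiantsHypothesis-22510`; cell valiant-natproofs, rung V4, 𝒟-side door (c); prover seat val-np-p1 gen 15;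
memo HOME/val-np-p1/g15/STARSTEP-RIGID-MEMO-valnp1-g15.md §2.3). Closes NO item.

`symbolicDet_one_cubeBall_ne_zero`: for `s = 1` (vertex–vertex anchors `(x_a | y_d)` only — the smallest anchored door, `h²` anchors),
`h = 2k+1`, rows ranging injectively over subsets of the first `2k` `x`-vertices and columns containing the radius-`k` `y`-ball,
`symbolicDet 1 (2k+1) r u w ≠ 0`. Proof: the landed cube-versus-ball brick witness `CubeBall.witness k k` (bricks `(x_a | y_a)` and
`(x_{2j} x_{2j+1} | y_d)`, `d ∈ Y_j`; nonsingular by hard Lefschetz, `det_cubeBall_witness_ne_zero`, p568617) has DISTINCT profile-one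
anchor representatives `(x_a | y_a)` and `(x_{2j} | y_d)` (`pairAnchorsOne`, `brickZ`, `brickProd_cubeBall`), so it is a degeneration of 𝔄₁
and the brick-degeneration lemma `symbolicDet_ne_zero_of_brickDegeneration` (`…BrickDegeneration`) applies. Compare p576008
(`symbolicDet_cubeBall_ne_zero`, the same for `s = 2`, where the pair bricks are honest anchors and evaluation at a 0/1 point suffices).
So on the cell's stress family — star(s)-step-free for every `s < k`, i.e. inside the residual class of `stub_rigidPairs` — even the
profile bound `s = 1` is enough, in line with the seat's census (𝔄₁ hits every structured star-step-free pair tested, h ≤ 13).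

WHAT THIS IS NOT: one family; nothing on `stub_rigidPairs` in general, on items 22510 / 19717 themselves, on crux
stmt-ValiantsHypothesis-14610, or on `VP` versus `VNP`.
-/

set_option linter.dupNamespace false

namespace Summit.ValiantsHypothesis.ValiantsHypothesis.Theorems.BarrierLever.AnchoredPeeling

open Finset MvPolynomial
open Summit.ValiantsHypothesis.ValiantsHypothesis.Theorems.BarrierLever.BrickCalculus (pexpo pexpo_def)

noncomputable section

/-! ## 4. Corollary: the profile-ONE door 𝔄₁ on cube-versus-Hamming-ball, every `k` -/

section CubeBallOne

open Summit.ValiantsHypothesis.ValiantsHypothesis.Theorems.BarrierLever.BrickCalculus (brick brick_eq)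
open Summit.ValiantsHypothesis.ValiantsHypothesis.Theorems.BarrierLever.CubeBall
open Summit.ValiantsHypothesis.ValiantsHypothesis.Theorems.BarrierLever.AnchoredDoor (witness_eq_prod prod_range_two_mul)

/-- The profile-one anchors `(x_{2j} | y_d)`, `j < k`, `d ∈ Y_j` (representatives of the pair bricks `(x_{2j}x_{2j+1} | y_d)`). -/
def pairAnchorsOne (k : ℕ) : Finset (Finset (Fin (2 * k + 1)) × Finset (Fin (2 * k + 1))) :=
  (Finset.range k).biUnion fun j => (ySet k j).image fun d => ({vtx k (2 * j)}, {d})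

/-- The brick `x`-part attached to an anchor: vertex anchors keep their vertex, the anchors `(x_{2j} | y_d)` get the pair
`{x_{2j}, x_{2j+1}}`. -/
def brickZ (k : ℕ) (α : Finset (Fin (2 * k + 1)) × Finset (Fin (2 * k + 1))) : Finset (Fin (2 * k + 1)) :=
  if α ∈ vertexAnchors k then α.1 else α.1 ∪ α.1.image fun v => vtx k (v.val + 1)

/-- A pair-derived anchor is not a vertex anchor (its `y`-vertex lies in `Y_j ∌ x_{2j}`). -/
theorem pairAnchorOne_not_mem_vertexAnchors {k j : ℕ} (hj : j < k) {d : Fin (2 * k + 1)} (hd : d ∈ ySet k j) :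
    (({vtx k (2 * j)}, {d}) : Finset (Fin (2 * k + 1)) × Finset (Fin (2 * k + 1))) ∉ vertexAnchors k := by
  intro hmem
  obtain ⟨a, -, ha⟩ := Finset.mem_image.mp hmem
  have h1 : a = vtx k (2 * j) := Finset.singleton_injective (congrArg Prod.fst ha)
  have h2 : a = d := Finset.singleton_injective (congrArg Prod.snd ha)
  rw [ySet, Finset.mem_insert, Finset.mem_image] at hd
  rcases hd with hd | ⟨i, hi, hd⟩
  · have := vtx_inj (by omega) le_rfl (h1.symm.trans (h2.trans hd)); omega
  · have hi' := Finset.mem_range.mp hi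
    have := vtx_inj (by omega) (by omega) (h1.symm.trans (h2.trans hd.symm)); omega

/-- Vertex anchors and pair-derived anchors are disjoint. -/
theorem disjoint_vertexAnchors_pairAnchorsOne (k : ℕ) : Disjoint (vertexAnchors k) (pairAnchorsOne k) := by
  rw [Finset.disjoint_right]
  intro α hα
  obtain ⟨j, hj, hα'⟩ := Finset.mem_biUnion.mp hα
  obtain ⟨d, hd, rfl⟩ := Finset.mem_image.mp hα'
  exact pairAnchorOne_not_mem_vertexAnchors (Finset.mem_range.mp hj) hd

/-- The brick of a pair-derived anchor is the pair brick. -/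
theorem brickZ_pair {k j : ℕ} (hj : j < k) {d : Fin (2 * k + 1)} (hd : d ∈ ySet k j) :
    brickZ k ({vtx k (2 * j)}, {d}) = {vtx k (2 * j), vtx k (2 * j + 1)} := by
  rw [brickZ, if_neg (pairAnchorOne_not_mem_vertexAnchors hj hd), Finset.image_singleton, ← Finset.insert_eq]
  congr 2
  simp only [vtx]
  congr 1
  omega

/-- The brick of a vertex anchor is the vertex. -/
theorem brickZ_vertex {k : ℕ} {α : Finset (Fin (2 * k + 1)) × Finset (Fin (2 * k + 1))} (hα : α ∈ vertexAnchors k) :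
    brickZ k α = α.1 := by
  rw [brickZ, if_pos hα]

/-- All these anchors have profile one. -/
theorem anchorsOne_subset (k : ℕ) : vertexAnchors k ∪ pairAnchorsOne k ⊆ anchors 1 (2 * k + 1) := by
  intro α hα
  rcases Finset.mem_union.mp hα with hα | hα
  · obtain ⟨a, -, rfl⟩ := Finset.mem_image.mp hα
    simp [anchors]
  · obtain ⟨j, -, hα'⟩ := Finset.mem_biUnion.mp hα
    obtain ⟨d, -, rfl⟩ := Finset.mem_image.mp hα'
    simp [anchors]

/-- Each anchor lies inside its brick. -/
theorem fst_subset_brickZ (k : ℕ) (α : Finset (Fin (2 * k + 1)) × Finset (Fin (2 * k + 1))) : α.1 ⊆ brickZ k α := by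
  rw [brickZ]
  split_ifs
  · exact subset_rfl
  · exact Finset.subset_union_left

/-- **The brick product attached to the profile-one anchors IS the cube-versus-ball witness.** -/
theorem brickProd_cubeBall (k : ℕ) :
    brickProd (vertexAnchors k ∪ pairAnchorsOne k) (brickZ k) (fun α => α.2) = witness k k := by
  classical
  rw [brickProd, Finset.prod_union (disjoint_vertexAnchors_pairAnchorsOne k)]
  -- vertex anchors
  have hV : ∏ α ∈ vertexAnchors k, (1 + monomial (pexpo (brickZ k α) α.2) (1 : ℂ)) = ∏ a ∈ xSet k k, brick {a} {a} := by
    rw [vertexAnchors, Finset.prod_image (fun a _ b _ hab => Finset.singleton_injective (congrArg Prod.fst hab))]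
    refine Finset.prod_congr rfl (fun a ha => ?_)
    rw [brickZ_vertex (Finset.mem_image.mpr ⟨a, ha, rfl⟩), brick_eq]
  -- pair-derived anchors
  have hP : ∏ α ∈ pairAnchorsOne k, (1 + monomial (pexpo (brickZ k α) α.2) (1 : ℂ)) =
      ∏ j ∈ Finset.range k, ∏ d ∈ ySet k j, brick {vtx k (2 * j), vtx k (2 * j + 1)} {d} := by
    rw [pairAnchorsOne, Finset.prod_biUnion]
    · refine Finset.prod_congr rfl (fun j hj => ?_)
      rw [Finset.prod_image (fun d _ d' _ hdd => Finset.singleton_injective (congrArg Prod.snd hdd))]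
      refine Finset.prod_congr rfl (fun d hd => ?_)
      rw [brickZ_pair (Finset.mem_range.mp hj) hd, brick_eq]
    · intro j hj j' hj' hjj
      rw [Function.onFun, Finset.disjoint_left]
      intro α hα hα'
      obtain ⟨d, -, rfl⟩ := Finset.mem_image.mp hα
      obtain ⟨d', -, hd'⟩ := Finset.mem_image.mp hα'
      have h1 := Finset.singleton_injective (congrArg Prod.fst hd')
      have hjk : j < k := Finset.mem_range.mp hj
      have hjk' : j' < k := Finset.mem_range.mp hj'
      have := vtx_inj (by omega) (by omega) h1
      omega
  rw [hV, hP, witness_eq_prod]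
  have hblock : ∀ j, blockW k j = (brick {vtx k (2 * j)} {vtx k (2 * j)} * brick {vtx k (2 * j + 1)} {vtx k (2 * j + 1)}) *
      ∏ d ∈ ySet k j, brick {vtx k (2 * j), vtx k (2 * j + 1)} {d} := fun j => rfl
  simp_rw [hblock]
  rw [Finset.prod_mul_distrib, ← prod_range_two_mul (fun i => brick {vtx k i} {vtx k i}) k, xSet, Finset.prod_image]
  intro i hi i' hi' hv
  exact vtx_inj (by have := Finset.mem_range.mp hi; omega) (by have := Finset.mem_range.mp hi'; omega) hv

/-- **The profile-ONE anchored door 𝔄₁ already has nonzero symbolic minor on cube-versus-Hamming-ball, for every `k`**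
(rows ranging injectively over subsets of the first `2k` `x`-vertices, columns containing the radius-`k` ball): the landed
cube-versus-ball witness degenerates from 𝔄₁ (its bricks have distinct vertex–vertex representatives). -/
theorem symbolicDet_one_cubeBall_ne_zero (k : ℕ) {r : ℕ} (u w : Fin r → Finset (Fin (2 * k + 1)))
    (hu : Function.Injective u) (hur : ∀ i, vtx k (2 * k) ∉ u i)
    (hwr : ∀ T : Finset (Fin (2 * k + 1)), T.card ≤ k → T ∈ Set.range w) :
    symbolicDet 1 (2 * k + 1) r u w ≠ 0 := by
  refine symbolicDet_ne_zero_of_brickDegeneration 1 (2 * k + 1) r u w (vertexAnchors k ∪ pairAnchorsOne k) (brickZ k)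
    (fun α => α.2) (anchorsOne_subset k) (fun α _ => fst_subset_brickZ k α) (fun α _ => subset_rfl) ?_
  rw [brickProd_cubeBall]
  exact det_cubeBall_witness_ne_zero k u w hu hur hwr

end CubeBallOne

end

end Summit.ValiantsHypothesis.ValiantsHypothesis.Theorems.BarrierLever.AnchoredPeeling
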